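import Summits.AtomisticToContinuum.HydrodynamicLimit.Theses.OneFlightGossipEngine
import Summits.AtomisticToContinuum.HydrodynamicLimit.Theorems.KineticCurrentsWindowLDUniform.Negative.LoadBearing
import Summits.AtomisticToContinuum.HydrodynamicLimit.Theorems.HydroLimitInBand.Negative.KineticInputSigmaZero
import Summits.AtomisticToContinuum.HydrodynamicLimit.Cruxes.KineticCurrentsWindowLDUniform.Disproof
import HarnessLib

/-!
# Disproof work file — crux `KineticCurrentsLDAlongFamilies` (stmt-AtomisticToContinuum-16659) — findings

Standing adversary record (cdisprove seat `refuter-cdisprove-stmt-AtomisticToContinuum-16659-0`, cycle 1; route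
`OneFlightGossipEngine`, rank-3 docking node KCWF, binder of `closes`; Iff.rfl twin of the dock line's
`KineticCurrentsWindowLDFamily` and of `HydroLimitInBand/Lines/IdeatorOneSketch.KineticCurrentsWindowLDFamily`).
The crux: `∃ η₀ > 0 ∀ t₁ ∀` jointly continuous one-parameter FAMILIES `s ↦ (a_s, θ_s, u_s)` (positive, guard
`σ³ sup a_s ≤ η₀ ∫ a_s` on `[0,t₁]`) `∀ σ > 0 ∀ Φ_N ∀` families of weights `(A_s, b_s, G_s)` with
`F_s = A_s(x):w⊗w + (b_s(x)·w) G_s(x,|w|²)`, `w = v − u_s(x)`, `|F_s| ≤ C(1+|v|²)` uniformly on `[0,t₁]`,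
`F_s ⊥ 1, v_j, |v|²` under `M_{1,u_s(x),θ_s(x)}`: `∃ β₀ ∀ |β| ≤ β₀ ∀ ε ∃ τ₀ ∀ τ ≥ τ₀ ∃ N₀ ∀ N ≥ N₀ ∀ s ∈ [0,t₁]:
∫ exp(β Σᵢ w_N⁻¹∫₀^{w_N} F_s(zᵢ(r)) dr) dλ^N_s ≤ e^{ε(N+1)}`, `w_N = τ(N+1)^{-1/3}`, `λ^N_s` the local Gibbs law.

## VERDICT (cycle 1): NO KILL. The crux RESISTS every cheap attack; what is decidable about its HYPOTHESES and
## QUANTIFIERS is decided below, all in Lean, sorry-free (five refuted variants + two structural implications here;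
## landing: `Theorems/KineticCurrentsLDAlongFamilies/Negative/Inherited.lean` p128137, `…/OrthScalars.lean` p128138).

* READ-BACK (W.lean rc 0; symbol by symbol). `λ^N_s = localGibbsLaw σ (a s) (u₀ s) (θ₀ s) N (Φ N)` is the normalised
  canonical local Gibbs measure — a probability measure for `σ ≤ 1/2` (tree `isProbabilityMeasure_localGibbsMeasure`;
  the guard gives `σ³ ≤ η₀ ∫a/sup a ≤ η₀`), `≪ Liouville`, so the junk values of `Φ.flow` off the good set are invisible;
  flows are CONSTRUCTIBLE (`HardSphereFlow.nonempty_torus_holds`, `Alexander.regHardSphereFlow`), so `∀ Φ` is instantiable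
  and every `¬`-lemma below is UNCONDITIONAL. Junk directions all favour the statement (non-measurable integrand lowers
  `∫⁻`; a non-integrable orbit functional gives interval integral `0`, on null sets only; at packing so high that the
  hard-sphere domain is null the law is `0` and the bound is trivially true — the guard excludes this anyway).
  `⨆ₓ a_s`, `∫ a_s` are fine (continuous on compact `𝕋³`, Haar probability); `t₁ < 0` makes everything vacuous (true);
  orthogonality integrands are integrable (quadratic growth × Gaussian), so the `= 0` rows are honest, not junk.
  The window is ALWAYS `[0, w_N]` from the time-`s` local Gibbs datum: `s` is a family parameter, not a dynamical time.
* THE FAMILY TYPING ADDS NO CHEAP ATTACK SURFACE. A constant family (`t₁ = 0`) is admissible, so the crux implies its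
  pointwise rung `KineticCurrentsWindowLDUniform` (stmt-14662) (`rung_of_crux`, §0) and every refuted VARIANT of the rung
  (rung disprover cdisprove-14662-0: `Theorems/KineticCurrentsWindowLDUniform/Negative/*`, and its work file) transfers
  to the same variant of the family crux by the constant-family specialisation (§(b), the `…_pointwise_of_family`
  reductions). Conversely, along a compact family `[0,t₁] × 𝕋³` every quantitative threshold of the rung's analysis stays
  finite: `β₀ ≤ 1/(2 sup_{s,x} θ_s(x) λ_max(A_s(x)))` (AllBeta), the class constant `C`, the moduli of continuity of
  `u_s`, `θ_s` entering the Knudsen correction — uniformity in `s` is a compactness upgrade of the pointwise mechanism,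
  not a new obstruction. The only family-specific strengthenings one could refute — thresholds uniform over a
  NON-compact family (`t₁ = ∞` with `θ_s → ∞`, killed by AllBeta's mechanism at `β₀ θ_s > 1/2`) or over `σ ↓ 0`
  (killed by the `σ = 0` free gas) — are not claimed by the crux.
* LOAD-BEARING TABLE (all in Lean, §(a)–(b)): `0 < σ` LB (tree, HydroLimitInBand disprover: free gas at `σ = 0`,
  `kineticCurrentsLDAlongFamilies_false_with_sigma_zero`) · `∃ N₀` LB (`not_…AllN`: one free sphere) · `∃ β₀` LB and
  `β₀ ≤ 1/(2 sup θ λ_max(A_sym))` uniformly in `τ` (`not_…AllBeta`: drift tilt, functional `+∞` for `β > 1`) ·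
  `⊥ v_j` LB (`not_…WithoutOrthMom`: `F = v₀`, conserved momentum) · `⊥ 1, ⊥ |v|²` jointly LB (`not_…WithoutOrthScalars`,
  NEW: `F = |v|²/3`, conserved energy, functional `≥ e^{(N+1)β}` for EVERY flow and window) · `⊥ 1` alone LB
  (`not_…WithoutOrthOne`, inherited from the rung's work file: `|u|² = 5θ`, `F = |w|² − 3√5 w₀`) · growth clause LB
  (`not_…WithoutGrowth`, inherited from the rung's work file: true heat flux `v₀(|v|²−5)`, functional `+∞`) ·
  `⊥ |v|²` alone REDUNDANT (rung's `Negative/OrthRedundant.lean`: implied by `⊥1 ∧ ⊥v_j` inside the class) ·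
  `η₀`-guard not refutably LB (dropping it makes the statement vacuously true at high packing) · continuity /
  positivity: technical.
* WHY THE CRUX RESISTS (for provers and planners; numbers, not adjectives).
  - Every STARVATION regime sits before `∃ τ₀`: `σ → 0` (`τσ²` mean free times per window), `min a → 0`, `θ → 0`;
    `τ₀ = τ₀(η₀, family, σ, Φ, weights, β, ε)` compensates all of them, and `N₀ = N₀(τ)` removes finite-`N` wrapping.
  - INVARIANT TILTS GAIN ONLY AT SECOND ORDER. Donsker–Varadhan over flow-INVARIANT laws (drifted / heated global
    Gibbs, the only invariant laws we can write down) gives `Λ(β) ≥ sup_μ [β E_μ F − h(μ|λ)]`; a bulk-velocity shift `U`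
    costs `|U|²/(2θ)` per particle and gains `β UᵀA U` — unprofitable iff `|β| < 1/(2θ λ_max(A))`, exactly the crux's
    `∃ β₀`; temperature tilts gain nothing on the `A`-part (`tr A = 0`) and nothing on the odd `b`-part; density tilts
    gain nothing (`F ⊥ 1`, velocities exactly Maxwellian at every density). The rung disprover's `tilt_window_lower_bound`
    is the sharp form: it certifies the table above and CANNOT refute the crux.
  - EXPLICIT-EVENT CERTIFICATES (the 13733 cradle, platoons, 1-d rod lattices, dilution voids) cannot bite: the
    one-body current is dominated by the conserved energy (`|Σᵢ F| ≤ C(N+1) + 2C E`), so an event of probability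
    `e^{−cN}` gains at most `β(C + 2C·3θ/2)N` — negative for `β < c/(C(1+3θ))`; a laminar (1-d) velocity structure
    surviving `k` dispersing collisions needs transverse precision `(σ³)^k`, cost `∝ k N log σ⁻¹ → ∞` with `τ`; a diluted
    region of volume `V` at relative density `ρ' ≤ 1/τ` costs `≈ V(1−ρ')N` and gains `≤ ρ' V N Λ_stat(β) → 0`.
  - MAZUR / quadratic charges: `⟨Σ v₀v₁, P₀P₁⟩²/⟨(P₀P₁)²⟩ = O(1)` in total, `O(1/N)` per particle; at LD scale the
    Galilean cost beats the gain for `βθ < 1/2`. Hydrodynamic tails `t^{-3/2}` are integrable in `d = 3`.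
  - LOCAL profiles and FAMILIES: over `w_N → 0` the Chapman–Enskog correction to `E F_s(zᵢ(r))` is
    `O(√θ · ω_{u_s}(ℓ_N) + ω_{θ_s}(ℓ_N))` per particle, uniformly in `s ∈ [0,t₁]` by joint continuity on a compact
    set: `o(N)` in the first cumulant, invisible at LD scale.
  - A counterexample needs a finite-entropy-density, kinetic-time-quasi-stationary, NON-Maxwellian velocity structure
    of 3-d hard spheres at small fixed density (a hidden extensive charge surviving `τσ²` collisions per particle,
    uniformly in `N`) — none is known; the exact witnesses (free gas `σ = 0`, one sphere `N = 0`, 1-d rods, `β` large)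
    are all excluded by the statement as typed.
  - BARRIERS (`Literature/Barriers/AtomisticToContinuum/`): `BoltzmannHypothesisBarrier` evaded in form (finite window,
    explicit data), its free-gas kernel is exactly the `σ = 0` / `N = 0` witnesses; `MazurBoundBallistic` only the
    `O(1/N)` floor; `HighMomentumCutoffBarrier` does not bite the quadratic class (it is the growth clause, §(a)).
* USED FROM THE TREE (cited): `KineticCurrentsWindowLDUniform/Negative/{ForallN, LoadBearing, TiltWindow, WindowSum,
  WindowFubini, OrthRedundant}` (cdisprove-14662-0), `Cruxes/KineticCurrentsWindowLDUniform/Disproof.lean` (its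
  `not_…WithoutGrowth`, `not_…WithoutOrthOne`), `HydroLimitInBand/Negative/KineticInputSigmaZero` (cdisprove-9133),
  `CorrectorPressureDecay/Negative/Frame` (product formula), Alexander flows.

## -- Targets: none yet (no line picked, `stuck_stubs = []`).
## Near-misses: none sorried. Superseded scratch (folder `Neg.lean`, rc 0): an exact-value toolkit over
## `Alexander.regHardSphereFlow` (`sum_windowAvg_eq_of_conserved`, `E e^{βW₀}`, `E e^{c|W|²}`) — not landed (the rung's
## tilt machinery subsumes it; 5 lemmas would be duplicates).
## HANDOFF (disprover): landed p128137 (Inherited: AllN, AllBeta, WithoutOrthMom), p128138 (OrthScalars) — review-queued.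
## Next regimes if re-armed: (i) family corollaries of the rung's WithoutGrowth / WithoutOrthOne once their Theorems files
## land (proofs ready in §(a')); (ii) the picked line's stubs; (iii) non-invariant (entropy-producing) reference laws for
## local-profile tilts — research-level, the honest frontier, shared with the rung.
-/

noncomputable section

namespace Summit.AtomisticToContinuum.HydrodynamicLimit.Cruxes.KineticCurrentsLDAlongFamilies.Disproof

open MeasureTheory ProbabilityTheory Real
open scoped ENNReal
open Literature.MathematicalPhysics.KineticTheory Literature.Analysis.FluidPDE
open Summit.AtomisticToContinuum.HydrodynamicLimit.Theses.OneFlightGossipEngine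
  (KineticCurrentsLDAlongFamilies KineticCurrentsWindowLDUniform)
open Summit.AtomisticToContinuum.HydrodynamicLimit.Theorems
open KineticCurrentsWindowLDUniformOneSphere (alexFlow)
open KineticCurrentsWindowLDUniformLoadBearing (sigmaOf sigmaOf_spec guard_sigmaOf)
open KineticCurrentsWindowTilt (tilt_window_lower_bound window_sum_const_mul)
open HydroLimitInBandNegative (integral_mul_localMaxwellian_eq_pi KineticCurrentsWindowLDFamilyWithZero
  kineticCurrentsWindowLDFamily_false_with_sigma_zero)
open Summit.AtomisticToContinuum.HydrodynamicLimit.Cruxes.KineticCurrentsWindowLDUniform.Disproof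
  (KineticCurrentsWindowLDUniformWithoutGrowth not_kineticCurrentsWindowLDUniformWithoutGrowth
   KineticCurrentsWindowLDUniformWithoutOrthOne not_kineticCurrentsWindowLDUniformWithoutOrthOne)

/-! ## §0 Structure: the crux implies its rung; `0 < σ` is load-bearing (tree) -/

/-- **The crux implies its constant-family rung** `KineticCurrentsWindowLDUniform` (stmt-14662, support item of the
route): constant family, `t₁ = 0`, `τ = τ₀`, `s = 0`. (Positive structural fact for provers — information only; a
refuter lands nothing positive.) [folklore] -/
theorem rung_of_crux (h : KineticCurrentsLDAlongFamilies) : KineticCurrentsWindowLDUniform := by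
  obtain ⟨η₀, hη₀, H⟩ := h
  refine ⟨η₀, hη₀, ?_⟩
  intro a θ₀ u₀ ha hθ hu ha0 hθ0 σ hσ hg Φ A b G hA hb hG hC h1 hv hE
  have H1 := H 0 (fun _ => a) (fun _ => θ₀) (fun _ => u₀) (ha.comp continuous_snd) (hθ.comp continuous_snd)
    (hu.comp continuous_snd) (fun _ x => ha0 x) (fun _ x => hθ0 x) σ hσ (fun _ _ => hg) Φ (fun _ => A) (fun _ => b)
    (fun _ => G) (hA.comp continuous_snd) (hb.comp continuous_snd) (hG.comp continuous_snd)
  dsimp only at H1 hC h1 hv hE ⊢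
  obtain ⟨C, hC⟩ := hC
  obtain ⟨β₀, hβ₀, Hβ⟩ := H1 ⟨C, fun _ _ y => hC y⟩ (fun _ _ x => h1 x) (fun _ _ x j => hv x j) (fun _ _ x => hE x)
  refine ⟨β₀, hβ₀, fun β hβ ε hε => ?_⟩
  obtain ⟨τ₀, hτ₀, Hτ⟩ := Hβ β hβ ε hε
  obtain ⟨N₀, HN⟩ := Hτ τ₀ le_rfl
  exact ⟨τ₀, hτ₀, N₀, fun N hN => HN N hN 0 ⟨le_rfl, le_rfl⟩⟩

/-- The `0 ≤ σ` relaxation refuted in the tree for the Iff.rfl twin (`HydroLimitInBandNegative.KineticCurrentsWindowLDFamilyWithZero`)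
is THIS crux with `0 < σ` weakened to `0 ≤ σ`: it implies the crux verbatim. [folklore] -/
theorem crux_of_withZero (h : KineticCurrentsWindowLDFamilyWithZero) : KineticCurrentsLDAlongFamilies := by
  obtain ⟨η₀, hη₀, H⟩ := h
  exact ⟨η₀, hη₀, fun t₁ a θ₀ u₀ ha hθ hu ha0 hθ0 σ hσ => H t₁ a θ₀ u₀ ha hθ hu ha0 hθ0 σ hσ.le⟩

/-- **`0 < σ` IS LOAD-BEARING** (cited from the tree, cdisprove-9133's `kineticCurrentsWindowLDFamily_false_with_sigma_zero`):
at `σ = 0` the free gas is a flow of the crux's type and `v₀² − v₁²` is never averaged; `τ₀(ε) ≳ σ⁻²`. [folklore] -/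
theorem kineticCurrentsLDAlongFamilies_false_with_sigma_zero : ¬ KineticCurrentsWindowLDFamilyWithZero :=
  kineticCurrentsWindowLDFamily_false_with_sigma_zero

/-! ## §(a) Load-bearing HYPOTHESES — refuted variants (hypothesis deleted, every other token verbatim) -/

/-! ### (a.1) the momentum row `F ⊥ v_j` (inherited from the rung; landing `Negative/Inherited.lean` p128137) -/

/-- FALSE — not a fact. The crux with the momentum row DELETED. -/
def KineticCurrentsLDAlongFamiliesWithoutOrthMom : Prop :=
  ∃ η₀ : ℝ, 0 < η₀ ∧ ∀ (t₁ : ℝ) (a θ₀ : ℝ → T3 → ℝ) (u₀ : ℝ → T3 → V3),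
    Continuous (Function.uncurry a) → Continuous (Function.uncurry θ₀) → Continuous (Function.uncurry u₀) →
    (∀ s x, 0 < a s x) → (∀ s x, 0 < θ₀ s x) →
    ∀ σ : ℝ, 0 < σ → (∀ s ∈ Set.Icc 0 t₁, σ ^ 3 * (⨆ x, a s x) ≤ η₀ * ∫ x, a s x) →
    ∀ Φ : (N : ℕ) → HardSphereFlow (Torus.geometry (Fin 3)) (hsDiameter σ N) (N + 1),
    ∀ (A : ℝ → T3 → Fin 3 → Fin 3 → ℝ) (b : ℝ → T3 → V3) (G : ℝ → T3 × ℝ → ℝ),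
    Continuous (Function.uncurry A) → Continuous (Function.uncurry b) → Continuous (Function.uncurry G) →
    (let F := fun (s : ℝ) (y : T3 × V3) =>
       (∑ j : Fin 3, ∑ k : Fin 3, A s y.1 j k * ((y.2 - u₀ s y.1) j * (y.2 - u₀ s y.1) k)) +
         (∑ j : Fin 3, b s y.1 j * (y.2 - u₀ s y.1) j) * G s (y.1, ‖y.2 - u₀ s y.1‖ ^ 2)
     (∃ C : ℝ, ∀ s ∈ Set.Icc 0 t₁, ∀ y : T3 × V3, |F s y| ≤ C * (1 + ‖y.2‖ ^ 2)) →
     (∀ s ∈ Set.Icc 0 t₁, ∀ x, ∫ v, F s (x, v) * localMaxwellian 1 (θ₀ s x) (u₀ s x) v = 0) →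
     (∀ s ∈ Set.Icc 0 t₁, ∀ x, ∫ v, F s (x, v) * ‖v‖ ^ 2 * localMaxwellian 1 (θ₀ s x) (u₀ s x) v = 0) →
     ∃ β₀ : ℝ, 0 < β₀ ∧ ∀ β : ℝ, |β| ≤ β₀ → ∀ ε : ℝ, 0 < ε → ∃ τ₀ : ℝ, 0 < τ₀ ∧ ∀ τ : ℝ, τ₀ ≤ τ →
     ∃ N₀ : ℕ, ∀ N : ℕ, N₀ ≤ N → ∀ s ∈ Set.Icc 0 t₁,
       ∫⁻ z, ENNReal.ofReal (Real.exp (β * ∑ i : Fin (N + 1),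
           (τ * ((N : ℝ) + 1) ^ (-(1 / 3 : ℝ)))⁻¹ *
             ∫ r in (0 : ℝ)..(τ * ((N : ℝ) + 1) ^ (-(1 / 3 : ℝ))), F s ((Φ N).flow r z i)))
         ∂(localGibbsLaw σ (a s) (u₀ s) (θ₀ s) N (Φ N)) ≤
       ENNReal.ofReal (Real.exp (ε * ((N : ℝ) + 1))))

theorem withoutOrthMom_pointwise_of_family (h : KineticCurrentsLDAlongFamiliesWithoutOrthMom) : KineticCurrentsWindowLDUniformWithoutOrthMom := by
  obtain ⟨η₀, hη₀, H⟩ := h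
  refine ⟨η₀, hη₀, ?_⟩
  intro a θ₀ u₀ ha hθ hu ha0 hθ0 σ hσ hg Φ A b G hA hb hG hC h1 hE
  have H1 := H 0 (fun _ => a) (fun _ => θ₀) (fun _ => u₀) (ha.comp continuous_snd) (hθ.comp continuous_snd)
    (hu.comp continuous_snd) (fun _ x => ha0 x) (fun _ x => hθ0 x) σ hσ (fun _ _ => hg) Φ (fun _ => A) (fun _ => b)
    (fun _ => G) (hA.comp continuous_snd) (hb.comp continuous_snd) (hG.comp continuous_snd)
  dsimp only at H1 hC h1 hE ⊢
  obtain ⟨C, hC⟩ := hC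
  obtain ⟨β₀, hβ₀, Hβ⟩ := H1 ⟨C, fun _ _ y => hC y⟩ (fun _ _ x => h1 x) (fun _ _ x => hE x)
  refine ⟨β₀, hβ₀, fun β hβ ε hε => ?_⟩
  obtain ⟨τ₀, hτ₀, Hτ⟩ := Hβ β hβ ε hε
  obtain ⟨N₀, HN⟩ := Hτ τ₀ le_rfl
  exact ⟨τ₀, hτ₀, N₀, fun N hN => HN N hN 0 ⟨le_rfl, le_rfl⟩⟩

/-- **`⊥ v_j` is load-bearing**: `F = v₀`, conserved momentum, functional `≥ e^{(N+1)β²/2}` at every window. [folklore] -/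
theorem not_kineticCurrentsLDAlongFamiliesWithoutOrthMom : ¬ KineticCurrentsLDAlongFamiliesWithoutOrthMom :=
  fun h => not_kineticCurrentsWindowLDUniformWithoutOrthMom (withoutOrthMom_pointwise_of_family h)

/-! ### (a.2) the scalar rows `F ⊥ 1`, `F ⊥ |v|²` jointly (NEW; landing `Negative/OrthScalars.lean` p128138) -/

/-- `A = I/3`. -/
def Athird : Fin 3 → Fin 3 → ℝ := fun j k => if j = k then 3⁻¹ else 0

/-- The functional at `A = I/3`, `b = 0`, `G = 0`, `u₀ = 0` is `|v|²/3`. [folklore] -/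
theorem energy_eq (v : V3) :
    (∑ j : Fin 3, ∑ k : Fin 3, Athird j k * ((v - 0) j * (v - 0) k)) + (∑ j : Fin 3, (0 : V3) j * (v - 0) j) * (0 : ℝ) =
      3⁻¹ * ‖v‖ ^ 2 := by
  simp [Athird, Fin.sum_univ_three, norm_sq_eq_sum_sq]
  ring

/-- Growth `|‖v‖²/3| ≤ 1 + |v|²`. [folklore] -/
theorem abs_energy_le (v : V3) : |3⁻¹ * ‖v‖ ^ 2| ≤ 1 * (1 + ‖v‖ ^ 2) := by
  rw [abs_of_nonneg (by positivity), one_mul]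
  nlinarith [sq_nonneg ‖v‖]

/-- `|v|²/3 ⊥ v_j` (odd moments). [folklore] -/
theorem norm_sq_orth_vel (j : Fin 3) : ∫ v, 3⁻¹ * ‖v‖ ^ 2 * v j * localMaxwellian 1 1 (0 : V3) v = 0 := by
  classical
  rw [integral_mul_localMaxwellian_eq_pi (g := fun v => 3⁻¹ * ‖v‖ ^ 2 * v j) (by fun_prop)]
  simp only [norm_sq_eq_sum_sq]
  have hpt : ∀ x : Fin 3 → ℝ, 3⁻¹ * (∑ l, (x l) ^ 2) * x j = ∑ l, 3⁻¹ * ((x l) ^ 2 * (x j) ^ 1) := by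
    intro x; rw [Finset.mul_sum, Finset.sum_mul]; refine Finset.sum_congr rfl fun l _ => by ring
  simp_rw [hpt]
  rw [integral_finsetSum _ fun l _ => (integrable_coord_pow_mul_coord_pow_pi l j 2 1).const_mul _]
  simp_rw [integral_const_mul, integral_coord_sq_mul_coord_pi, mul_zero, Finset.sum_const_zero]

/-- **TIGHTNESS-type bound: `∫ exp(β Σᵢ w⁻¹∫₀ʷ |vᵢ(r)|²/3) dG_N ≥ e^{(N+1)β}`** for EVERY `σ ≤ 1/2`, `N`, flow, window
(zero-drift `tilt_window_lower_bound`; `E_γ|W|²/3 = 1`): the conserved energy is not averaged. [folklore] -/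
theorem exp_le_lintegral_exp_energy_window {σ : ℝ} (hσ2 : σ ≤ 1 / 2) {N : ℕ}
    (Φ : HardSphereFlow (Torus.geometry (Fin 3)) (hsDiameter σ N) (N + 1)) {w : ℝ} (hw : 0 < w) (β : ℝ) :
    ENNReal.ofReal (Real.exp (((N : ℝ) + 1) * β)) ≤
      ∫⁻ z, ENNReal.ofReal (Real.exp (β * ∑ i, w⁻¹ * ∫ r in (0 : ℝ)..w, 3⁻¹ * ‖((Φ.flow r z) i).2‖ ^ 2))
        ∂(localGibbsLaw σ (fun _ => 1) (fun _ => 0) (fun _ => 1) N Φ) := by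
  have hC : ∀ v : V3, |β * (3⁻¹ * ‖v‖ ^ 2)| ≤ |β| * (1 + ‖v‖ ^ 2) ^ 1 := by
    intro v
    rw [pow_one, abs_mul]
    exact mul_le_mul_of_nonneg_left (by simpa using abs_energy_le v) (abs_nonneg β)
  have hkey := tilt_window_lower_bound hσ2 Φ (0 : V3) hw (g := fun v => β * (3⁻¹ * ‖v‖ ^ 2)) (by fun_prop) hC
  have hmean : ∫ v, β * (3⁻¹ * ‖v‖ ^ 2) ∂gaussMeasure (0 : V3) 1 = β := by
    rw [integral_const_mul, integral_const_mul, CorrectorPressureDecayNegative.gaussMeasure_zero_one,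
      integral_norm_sq_stdGaussian, Fintype.card_fin]
    push_cast
    ring
  rw [hmean, norm_zero] at hkey
  simp_rw [window_sum_const_mul Φ w β (fun v : V3 => 3⁻¹ * ‖v‖ ^ 2)] at hkey
  have hexp : ((N : ℝ) + 1) * (β - (0 : ℝ) ^ 2 / 2) = ((N : ℝ) + 1) * β := by ring
  rw [hexp] at hkey
  exact hkey

/-- FALSE — not a fact. The crux with the two scalar rows `F ⊥ 1`, `F ⊥ |v|²` DELETED (momentum row kept). -/
def KineticCurrentsLDAlongFamiliesWithoutOrthScalars : Prop :=
  ∃ η₀ : ℝ, 0 < η₀ ∧ ∀ (t₁ : ℝ) (a θ₀ : ℝ → T3 → ℝ) (u₀ : ℝ → T3 → V3),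
    Continuous (Function.uncurry a) → Continuous (Function.uncurry θ₀) → Continuous (Function.uncurry u₀) →
    (∀ s x, 0 < a s x) → (∀ s x, 0 < θ₀ s x) →
    ∀ σ : ℝ, 0 < σ → (∀ s ∈ Set.Icc 0 t₁, σ ^ 3 * (⨆ x, a s x) ≤ η₀ * ∫ x, a s x) →
    ∀ Φ : (N : ℕ) → HardSphereFlow (Torus.geometry (Fin 3)) (hsDiameter σ N) (N + 1),
    ∀ (A : ℝ → T3 → Fin 3 → Fin 3 → ℝ) (b : ℝ → T3 → V3) (G : ℝ → T3 × ℝ → ℝ),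
    Continuous (Function.uncurry A) → Continuous (Function.uncurry b) → Continuous (Function.uncurry G) →
    (let F := fun (s : ℝ) (y : T3 × V3) =>
       (∑ j : Fin 3, ∑ k : Fin 3, A s y.1 j k * ((y.2 - u₀ s y.1) j * (y.2 - u₀ s y.1) k)) +
         (∑ j : Fin 3, b s y.1 j * (y.2 - u₀ s y.1) j) * G s (y.1, ‖y.2 - u₀ s y.1‖ ^ 2)
     (∃ C : ℝ, ∀ s ∈ Set.Icc 0 t₁, ∀ y : T3 × V3, |F s y| ≤ C * (1 + ‖y.2‖ ^ 2)) →
     (∀ s ∈ Set.Icc 0 t₁, ∀ x (j : Fin 3),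
        ∫ v, F s (x, v) * v j * localMaxwellian 1 (θ₀ s x) (u₀ s x) v = 0) →
     ∃ β₀ : ℝ, 0 < β₀ ∧ ∀ β : ℝ, |β| ≤ β₀ → ∀ ε : ℝ, 0 < ε → ∃ τ₀ : ℝ, 0 < τ₀ ∧ ∀ τ : ℝ, τ₀ ≤ τ →
     ∃ N₀ : ℕ, ∀ N : ℕ, N₀ ≤ N → ∀ s ∈ Set.Icc 0 t₁,
       ∫⁻ z, ENNReal.ofReal (Real.exp (β * ∑ i : Fin (N + 1),
           (τ * ((N : ℝ) + 1) ^ (-(1 / 3 : ℝ)))⁻¹ *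
             ∫ r in (0 : ℝ)..(τ * ((N : ℝ) + 1) ^ (-(1 / 3 : ℝ))), F s ((Φ N).flow r z i)))
         ∂(localGibbsLaw σ (a s) (u₀ s) (θ₀ s) N (Φ N)) ≤
       ENNReal.ofReal (Real.exp (ε * ((N : ℝ) + 1))))

/-- **The scalar rows are load-bearing**: `F = |v|²/3`, `β = β₀`, `ε = β₀/2`, functional `≥ e^{(N₀+1)β₀}`. [folklore] -/
theorem not_kineticCurrentsLDAlongFamiliesWithoutOrthScalars : ¬ KineticCurrentsLDAlongFamiliesWithoutOrthScalars := by
  rintro ⟨η₀, hη₀, h⟩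
  obtain ⟨hσpos, hσ4, -, -⟩ := sigmaOf_spec hη₀
  have hσhalf : sigmaOf η₀ ≤ 1 / 2 := hσ4.trans (by norm_num)
  have hσhalf' : sigmaOf η₀ < 2⁻¹ := hσ4.trans_lt (by norm_num)
  have hmain := h 0 (fun _ _ => 1) (fun _ _ => 1) (fun _ _ => 0) continuous_const continuous_const continuous_const
    (fun _ _ => one_pos) (fun _ _ => one_pos) (sigmaOf η₀) hσpos (fun _ _ => guard_sigmaOf hη₀) (alexFlow hσpos hσhalf')
    (fun _ _ => Athird) (fun _ _ => 0) (fun _ _ => 0) continuous_const continuous_const continuous_const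
  dsimp only at hmain
  simp only [energy_eq] at hmain
  obtain ⟨β₀, hβ₀, hβ⟩ := hmain ⟨1, fun _ _ y => abs_energy_le y.2⟩ (fun _ _ _ j => norm_sq_orth_vel j)
  obtain ⟨τ₀, hτ₀, hτ⟩ := hβ β₀ (by rw [abs_of_pos hβ₀]) (β₀ / 2) (by positivity)
  obtain ⟨N₀, hN⟩ := hτ τ₀ le_rfl
  have h0 := hN N₀ le_rfl 0 ⟨le_rfl, le_rfl⟩
  have hw : 0 < τ₀ * ((N₀ : ℝ) + 1) ^ (-(1 / 3 : ℝ)) := mul_pos hτ₀ (Real.rpow_pos_of_pos (by positivity) _)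
  have hlow := exp_le_lintegral_exp_energy_window hσhalf (alexFlow hσpos hσhalf' N₀) hw β₀
  have hle : ENNReal.ofReal (Real.exp (((N₀ : ℝ) + 1) * β₀)) ≤
      ENNReal.ofReal (Real.exp (β₀ / 2 * ((N₀ : ℝ) + 1))) := hlow.trans h0
  rw [ENNReal.ofReal_le_ofReal_iff (Real.exp_pos _).le, Real.exp_le_exp] at hle
  have hN1 : (0 : ℝ) < (N₀ : ℝ) + 1 := by positivity
  nlinarith [hle, hβ₀, mul_pos hN1 hβ₀]

/-! ### (a.3) the row `F ⊥ 1` ALONE (inherited from the rung's WORK file; to be landed once its `LoadBearingOrthOne` lands) -/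

/-- FALSE — not a fact. The crux with the row `F ⊥ 1` DELETED (`⊥ v_j`, `⊥ |v|²` kept: the witness must sit at
`|u|² = 5θ`). -/
def KineticCurrentsLDAlongFamiliesWithoutOrthOne : Prop :=
  ∃ η₀ : ℝ, 0 < η₀ ∧ ∀ (t₁ : ℝ) (a θ₀ : ℝ → T3 → ℝ) (u₀ : ℝ → T3 → V3),
    Continuous (Function.uncurry a) → Continuous (Function.uncurry θ₀) → Continuous (Function.uncurry u₀) →
    (∀ s x, 0 < a s x) → (∀ s x, 0 < θ₀ s x) →
    ∀ σ : ℝ, 0 < σ → (∀ s ∈ Set.Icc 0 t₁, σ ^ 3 * (⨆ x, a s x) ≤ η₀ * ∫ x, a s x) →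
    ∀ Φ : (N : ℕ) → HardSphereFlow (Torus.geometry (Fin 3)) (hsDiameter σ N) (N + 1),
    ∀ (A : ℝ → T3 → Fin 3 → Fin 3 → ℝ) (b : ℝ → T3 → V3) (G : ℝ → T3 × ℝ → ℝ),
    Continuous (Function.uncurry A) → Continuous (Function.uncurry b) → Continuous (Function.uncurry G) →
    (let F := fun (s : ℝ) (y : T3 × V3) =>
       (∑ j : Fin 3, ∑ k : Fin 3, A s y.1 j k * ((y.2 - u₀ s y.1) j * (y.2 - u₀ s y.1) k)) +
         (∑ j : Fin 3, b s y.1 j * (y.2 - u₀ s y.1) j) * G s (y.1, ‖y.2 - u₀ s y.1‖ ^ 2)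
     (∃ C : ℝ, ∀ s ∈ Set.Icc 0 t₁, ∀ y : T3 × V3, |F s y| ≤ C * (1 + ‖y.2‖ ^ 2)) →
     (∀ s ∈ Set.Icc 0 t₁, ∀ x (j : Fin 3),
        ∫ v, F s (x, v) * v j * localMaxwellian 1 (θ₀ s x) (u₀ s x) v = 0) →
     (∀ s ∈ Set.Icc 0 t₁, ∀ x, ∫ v, F s (x, v) * ‖v‖ ^ 2 * localMaxwellian 1 (θ₀ s x) (u₀ s x) v = 0) →
     ∃ β₀ : ℝ, 0 < β₀ ∧ ∀ β : ℝ, |β| ≤ β₀ → ∀ ε : ℝ, 0 < ε → ∃ τ₀ : ℝ, 0 < τ₀ ∧ ∀ τ : ℝ, τ₀ ≤ τ →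
     ∃ N₀ : ℕ, ∀ N : ℕ, N₀ ≤ N → ∀ s ∈ Set.Icc 0 t₁,
       ∫⁻ z, ENNReal.ofReal (Real.exp (β * ∑ i : Fin (N + 1),
           (τ * ((N : ℝ) + 1) ^ (-(1 / 3 : ℝ)))⁻¹ *
             ∫ r in (0 : ℝ)..(τ * ((N : ℝ) + 1) ^ (-(1 / 3 : ℝ))), F s ((Φ N).flow r z i)))
         ∂(localGibbsLaw σ (a s) (u₀ s) (θ₀ s) N (Φ N)) ≤
       ENNReal.ofReal (Real.exp (ε * ((N : ℝ) + 1))))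

theorem withoutOrthOne_pointwise_of_family (h : KineticCurrentsLDAlongFamiliesWithoutOrthOne) : KineticCurrentsWindowLDUniformWithoutOrthOne := by
  obtain ⟨η₀, hη₀, H⟩ := h
  refine ⟨η₀, hη₀, ?_⟩
  intro a θ₀ u₀ ha hθ hu ha0 hθ0 σ hσ hg Φ A b G hA hb hG hC hv hE
  have H1 := H 0 (fun _ => a) (fun _ => θ₀) (fun _ => u₀) (ha.comp continuous_snd) (hθ.comp continuous_snd)
    (hu.comp continuous_snd) (fun _ x => ha0 x) (fun _ x => hθ0 x) σ hσ (fun _ _ => hg) Φ (fun _ => A) (fun _ => b)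
    (fun _ => G) (hA.comp continuous_snd) (hb.comp continuous_snd) (hG.comp continuous_snd)
  dsimp only at H1 hC hv hE ⊢
  obtain ⟨C, hC⟩ := hC
  obtain ⟨β₀, hβ₀, Hβ⟩ := H1 ⟨C, fun _ _ y => hC y⟩ (fun _ _ x j => hv x j) (fun _ _ x => hE x)
  refine ⟨β₀, hβ₀, fun β hβ ε hε => ?_⟩
  obtain ⟨τ₀, hτ₀, Hτ⟩ := Hβ β hβ ε hε
  obtain ⟨N₀, HN⟩ := Hτ τ₀ le_rfl
  exact ⟨τ₀, hτ₀, N₀, fun N hN => HN N hN 0 ⟨le_rfl, le_rfl⟩⟩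

/-- **`⊥ 1` alone is load-bearing**: `θ = 1`, `u ≡ √5 e₀`, `F = |w|² − 3√5 w₀` (`⊥ v_j`, `⊥ |v|²`, not `⊥ 1`),
functional `≥ e^{3β(N+1)}`. [folklore] -/
theorem not_kineticCurrentsLDAlongFamiliesWithoutOrthOne : ¬ KineticCurrentsLDAlongFamiliesWithoutOrthOne :=
  fun h => not_kineticCurrentsWindowLDUniformWithoutOrthOne (withoutOrthOne_pointwise_of_family h)

/-! ### (a.4) the growth clause (inherited from the rung's WORK file; to be landed once its `LoadBearingGrowth` lands) -/

/-- FALSE — not a fact. The crux with the class bound `∃ C ∀ s ∈ [0,t₁] ∀ y, |F_s y| ≤ C(1+‖y.2‖²)` DELETED. -/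
def KineticCurrentsLDAlongFamiliesWithoutGrowth : Prop :=
  ∃ η₀ : ℝ, 0 < η₀ ∧ ∀ (t₁ : ℝ) (a θ₀ : ℝ → T3 → ℝ) (u₀ : ℝ → T3 → V3),
    Continuous (Function.uncurry a) → Continuous (Function.uncurry θ₀) → Continuous (Function.uncurry u₀) →
    (∀ s x, 0 < a s x) → (∀ s x, 0 < θ₀ s x) →
    ∀ σ : ℝ, 0 < σ → (∀ s ∈ Set.Icc 0 t₁, σ ^ 3 * (⨆ x, a s x) ≤ η₀ * ∫ x, a s x) →
    ∀ Φ : (N : ℕ) → HardSphereFlow (Torus.geometry (Fin 3)) (hsDiameter σ N) (N + 1),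
    ∀ (A : ℝ → T3 → Fin 3 → Fin 3 → ℝ) (b : ℝ → T3 → V3) (G : ℝ → T3 × ℝ → ℝ),
    Continuous (Function.uncurry A) → Continuous (Function.uncurry b) → Continuous (Function.uncurry G) →
    (let F := fun (s : ℝ) (y : T3 × V3) =>
       (∑ j : Fin 3, ∑ k : Fin 3, A s y.1 j k * ((y.2 - u₀ s y.1) j * (y.2 - u₀ s y.1) k)) +
         (∑ j : Fin 3, b s y.1 j * (y.2 - u₀ s y.1) j) * G s (y.1, ‖y.2 - u₀ s y.1‖ ^ 2)
     (∀ s ∈ Set.Icc 0 t₁, ∀ x, ∫ v, F s (x, v) * localMaxwellian 1 (θ₀ s x) (u₀ s x) v = 0) →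
     (∀ s ∈ Set.Icc 0 t₁, ∀ x (j : Fin 3),
        ∫ v, F s (x, v) * v j * localMaxwellian 1 (θ₀ s x) (u₀ s x) v = 0) →
     (∀ s ∈ Set.Icc 0 t₁, ∀ x, ∫ v, F s (x, v) * ‖v‖ ^ 2 * localMaxwellian 1 (θ₀ s x) (u₀ s x) v = 0) →
     ∃ β₀ : ℝ, 0 < β₀ ∧ ∀ β : ℝ, |β| ≤ β₀ → ∀ ε : ℝ, 0 < ε → ∃ τ₀ : ℝ, 0 < τ₀ ∧ ∀ τ : ℝ, τ₀ ≤ τ →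
     ∃ N₀ : ℕ, ∀ N : ℕ, N₀ ≤ N → ∀ s ∈ Set.Icc 0 t₁,
       ∫⁻ z, ENNReal.ofReal (Real.exp (β * ∑ i : Fin (N + 1),
           (τ * ((N : ℝ) + 1) ^ (-(1 / 3 : ℝ)))⁻¹ *
             ∫ r in (0 : ℝ)..(τ * ((N : ℝ) + 1) ^ (-(1 / 3 : ℝ))), F s ((Φ N).flow r z i)))
         ∂(localGibbsLaw σ (a s) (u₀ s) (θ₀ s) N (Φ N)) ≤
       ENNReal.ofReal (Real.exp (ε * ((N : ℝ) + 1))))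

theorem withoutGrowth_pointwise_of_family (h : KineticCurrentsLDAlongFamiliesWithoutGrowth) : KineticCurrentsWindowLDUniformWithoutGrowth := by
  obtain ⟨η₀, hη₀, H⟩ := h
  refine ⟨η₀, hη₀, ?_⟩
  intro a θ₀ u₀ ha hθ hu ha0 hθ0 σ hσ hg Φ A b G hA hb hG h1 hv hE
  have H1 := H 0 (fun _ => a) (fun _ => θ₀) (fun _ => u₀) (ha.comp continuous_snd) (hθ.comp continuous_snd)
    (hu.comp continuous_snd) (fun _ x => ha0 x) (fun _ x => hθ0 x) σ hσ (fun _ _ => hg) Φ (fun _ => A) (fun _ => b)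
    (fun _ => G) (hA.comp continuous_snd) (hb.comp continuous_snd) (hG.comp continuous_snd)
  dsimp only at H1 h1 hv hE ⊢
  obtain ⟨β₀, hβ₀, Hβ⟩ := H1 (fun _ _ x => h1 x) (fun _ _ x j => hv x j) (fun _ _ x => hE x)
  refine ⟨β₀, hβ₀, fun β hβ ε hε => ?_⟩
  obtain ⟨τ₀, hτ₀, Hτ⟩ := Hβ β hβ ε hε
  obtain ⟨N₀, HN⟩ := Hτ τ₀ le_rfl
  exact ⟨τ₀, hτ₀, N₀, fun N hN => HN N hN 0 ⟨le_rfl, le_rfl⟩⟩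

/-- **The growth clause is load-bearing**: the true heat flux `v₀(|v|² − 5)` has functional `+∞` at every `β > 0`,
window and flow (dynamic form of the `HighMomentumCutoff` kernel). [folklore] -/
theorem not_kineticCurrentsLDAlongFamiliesWithoutGrowth : ¬ KineticCurrentsLDAlongFamiliesWithoutGrowth :=
  fun h => not_kineticCurrentsWindowLDUniformWithoutGrowth (withoutGrowth_pointwise_of_family h)

/-! ## §(b) Refuted natural STRENGTHENINGS (quantifiers; inherited from the rung; landing `Negative/Inherited.lean`) -/

/-- FALSE — not a fact. The crux with `∃ N₀ ∀ N ≥ N₀` strengthened to `∀ N`. -/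
def KineticCurrentsLDAlongFamiliesAllN : Prop :=
  ∃ η₀ : ℝ, 0 < η₀ ∧ ∀ (t₁ : ℝ) (a θ₀ : ℝ → T3 → ℝ) (u₀ : ℝ → T3 → V3),
    Continuous (Function.uncurry a) → Continuous (Function.uncurry θ₀) → Continuous (Function.uncurry u₀) →
    (∀ s x, 0 < a s x) → (∀ s x, 0 < θ₀ s x) →
    ∀ σ : ℝ, 0 < σ → (∀ s ∈ Set.Icc 0 t₁, σ ^ 3 * (⨆ x, a s x) ≤ η₀ * ∫ x, a s x) →
    ∀ Φ : (N : ℕ) → HardSphereFlow (Torus.geometry (Fin 3)) (hsDiameter σ N) (N + 1),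
    ∀ (A : ℝ → T3 → Fin 3 → Fin 3 → ℝ) (b : ℝ → T3 → V3) (G : ℝ → T3 × ℝ → ℝ),
    Continuous (Function.uncurry A) → Continuous (Function.uncurry b) → Continuous (Function.uncurry G) →
    (let F := fun (s : ℝ) (y : T3 × V3) =>
       (∑ j : Fin 3, ∑ k : Fin 3, A s y.1 j k * ((y.2 - u₀ s y.1) j * (y.2 - u₀ s y.1) k)) +
         (∑ j : Fin 3, b s y.1 j * (y.2 - u₀ s y.1) j) * G s (y.1, ‖y.2 - u₀ s y.1‖ ^ 2)
     (∃ C : ℝ, ∀ s ∈ Set.Icc 0 t₁, ∀ y : T3 × V3, |F s y| ≤ C * (1 + ‖y.2‖ ^ 2)) →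
     (∀ s ∈ Set.Icc 0 t₁, ∀ x, ∫ v, F s (x, v) * localMaxwellian 1 (θ₀ s x) (u₀ s x) v = 0) →
     (∀ s ∈ Set.Icc 0 t₁, ∀ x (j : Fin 3),
        ∫ v, F s (x, v) * v j * localMaxwellian 1 (θ₀ s x) (u₀ s x) v = 0) →
     (∀ s ∈ Set.Icc 0 t₁, ∀ x, ∫ v, F s (x, v) * ‖v‖ ^ 2 * localMaxwellian 1 (θ₀ s x) (u₀ s x) v = 0) →
     ∃ β₀ : ℝ, 0 < β₀ ∧ ∀ β : ℝ, |β| ≤ β₀ → ∀ ε : ℝ, 0 < ε → ∃ τ₀ : ℝ, 0 < τ₀ ∧ ∀ τ : ℝ, τ₀ ≤ τ →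
     ∀ N : ℕ, ∀ s ∈ Set.Icc 0 t₁,
       ∫⁻ z, ENNReal.ofReal (Real.exp (β * ∑ i : Fin (N + 1),
           (τ * ((N : ℝ) + 1) ^ (-(1 / 3 : ℝ)))⁻¹ *
             ∫ r in (0 : ℝ)..(τ * ((N : ℝ) + 1) ^ (-(1 / 3 : ℝ))), F s ((Φ N).flow r z i)))
         ∂(localGibbsLaw σ (a s) (u₀ s) (θ₀ s) N (Φ N)) ≤
       ENNReal.ofReal (Real.exp (ε * ((N : ℝ) + 1))))

theorem allN_pointwise_of_family (h : KineticCurrentsLDAlongFamiliesAllN) : KineticCurrentsWindowLDUniformAllN := by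
  obtain ⟨η₀, hη₀, H⟩ := h
  refine ⟨η₀, hη₀, ?_⟩
  intro a θ₀ u₀ ha hθ hu ha0 hθ0 σ hσ hg Φ A b G hA hb hG hC h1 hv hE
  have H1 := H 0 (fun _ => a) (fun _ => θ₀) (fun _ => u₀) (ha.comp continuous_snd) (hθ.comp continuous_snd)
    (hu.comp continuous_snd) (fun _ x => ha0 x) (fun _ x => hθ0 x) σ hσ (fun _ _ => hg) Φ (fun _ => A) (fun _ => b)
    (fun _ => G) (hA.comp continuous_snd) (hb.comp continuous_snd) (hG.comp continuous_snd)
  dsimp only at H1 hC h1 hv hE ⊢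
  obtain ⟨C, hC⟩ := hC
  obtain ⟨β₀, hβ₀, Hβ⟩ := H1 ⟨C, fun _ _ y => hC y⟩ (fun _ _ x => h1 x) (fun _ _ x j => hv x j) (fun _ _ x => hE x)
  refine ⟨β₀, hβ₀, fun β hβ ε hε => ?_⟩
  obtain ⟨τ₀, hτ₀, Hτ⟩ := Hβ β hβ ε hε
  exact ⟨τ₀, hτ₀, fun N => Hτ τ₀ le_rfl N 0 ⟨le_rfl, le_rfl⟩⟩

/-- **`∃ N₀` is load-bearing**: one free sphere (`N = 0`) keeps `v₀v₁` frozen at every window. [folklore] -/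
theorem not_kineticCurrentsLDAlongFamiliesAllN : ¬ KineticCurrentsLDAlongFamiliesAllN :=
  fun h => not_kineticCurrentsWindowLDUniformAllN (allN_pointwise_of_family h)

/-- FALSE — not a fact. The crux with `∃ β₀ > 0 ∀ |β| ≤ β₀` strengthened to `∀ β`. -/
def KineticCurrentsLDAlongFamiliesAllBeta : Prop :=
  ∃ η₀ : ℝ, 0 < η₀ ∧ ∀ (t₁ : ℝ) (a θ₀ : ℝ → T3 → ℝ) (u₀ : ℝ → T3 → V3),
    Continuous (Function.uncurry a) → Continuous (Function.uncurry θ₀) → Continuous (Function.uncurry u₀) →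
    (∀ s x, 0 < a s x) → (∀ s x, 0 < θ₀ s x) →
    ∀ σ : ℝ, 0 < σ → (∀ s ∈ Set.Icc 0 t₁, σ ^ 3 * (⨆ x, a s x) ≤ η₀ * ∫ x, a s x) →
    ∀ Φ : (N : ℕ) → HardSphereFlow (Torus.geometry (Fin 3)) (hsDiameter σ N) (N + 1),
    ∀ (A : ℝ → T3 → Fin 3 → Fin 3 → ℝ) (b : ℝ → T3 → V3) (G : ℝ → T3 × ℝ → ℝ),
    Continuous (Function.uncurry A) → Continuous (Function.uncurry b) → Continuous (Function.uncurry G) →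
    (let F := fun (s : ℝ) (y : T3 × V3) =>
       (∑ j : Fin 3, ∑ k : Fin 3, A s y.1 j k * ((y.2 - u₀ s y.1) j * (y.2 - u₀ s y.1) k)) +
         (∑ j : Fin 3, b s y.1 j * (y.2 - u₀ s y.1) j) * G s (y.1, ‖y.2 - u₀ s y.1‖ ^ 2)
     (∃ C : ℝ, ∀ s ∈ Set.Icc 0 t₁, ∀ y : T3 × V3, |F s y| ≤ C * (1 + ‖y.2‖ ^ 2)) →
     (∀ s ∈ Set.Icc 0 t₁, ∀ x, ∫ v, F s (x, v) * localMaxwellian 1 (θ₀ s x) (u₀ s x) v = 0) →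
     (∀ s ∈ Set.Icc 0 t₁, ∀ x (j : Fin 3),
        ∫ v, F s (x, v) * v j * localMaxwellian 1 (θ₀ s x) (u₀ s x) v = 0) →
     (∀ s ∈ Set.Icc 0 t₁, ∀ x, ∫ v, F s (x, v) * ‖v‖ ^ 2 * localMaxwellian 1 (θ₀ s x) (u₀ s x) v = 0) →
     ∀ β : ℝ, ∀ ε : ℝ, 0 < ε → ∃ τ₀ : ℝ, 0 < τ₀ ∧ ∀ τ : ℝ, τ₀ ≤ τ →
     ∃ N₀ : ℕ, ∀ N : ℕ, N₀ ≤ N → ∀ s ∈ Set.Icc 0 t₁,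
       ∫⁻ z, ENNReal.ofReal (Real.exp (β * ∑ i : Fin (N + 1),
           (τ * ((N : ℝ) + 1) ^ (-(1 / 3 : ℝ)))⁻¹ *
             ∫ r in (0 : ℝ)..(τ * ((N : ℝ) + 1) ^ (-(1 / 3 : ℝ))), F s ((Φ N).flow r z i)))
         ∂(localGibbsLaw σ (a s) (u₀ s) (θ₀ s) N (Φ N)) ≤
       ENNReal.ofReal (Real.exp (ε * ((N : ℝ) + 1))))

theorem allBeta_pointwise_of_family (h : KineticCurrentsLDAlongFamiliesAllBeta) : KineticCurrentsWindowLDUniformAllBeta := by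
  obtain ⟨η₀, hη₀, H⟩ := h
  refine ⟨η₀, hη₀, ?_⟩
  intro a θ₀ u₀ ha hθ hu ha0 hθ0 σ hσ hg Φ A b G hA hb hG hC h1 hv hE β ε hε
  have H1 := H 0 (fun _ => a) (fun _ => θ₀) (fun _ => u₀) (ha.comp continuous_snd) (hθ.comp continuous_snd)
    (hu.comp continuous_snd) (fun _ x => ha0 x) (fun _ x => hθ0 x) σ hσ (fun _ _ => hg) Φ (fun _ => A) (fun _ => b)
    (fun _ => G) (hA.comp continuous_snd) (hb.comp continuous_snd) (hG.comp continuous_snd)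
  dsimp only at H1 hC h1 hv hE ⊢
  obtain ⟨C, hC⟩ := hC
  obtain ⟨τ₀, hτ₀, Hτ⟩ := H1 ⟨C, fun _ _ y => hC y⟩ (fun _ _ x => h1 x) (fun _ _ x j => hv x j) (fun _ _ x => hE x) β ε hε
  obtain ⟨N₀, HN⟩ := Hτ τ₀ le_rfl
  exact ⟨τ₀, hτ₀, N₀, fun N hN => HN N hN 0 ⟨le_rfl, le_rfl⟩⟩

/-- **`∃ β₀` is load-bearing, quantitatively** (`β₀ ≤ 1/(2 sup_{s,x} θ_s(x) λ_max(A_s(x)))`, uniformly in `τ`): the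
shear stress at `β = 2 > 1` has functional `+∞` for every flow and window. [folklore] -/
theorem not_kineticCurrentsLDAlongFamiliesAllBeta : ¬ KineticCurrentsLDAlongFamiliesAllBeta :=
  fun h => not_kineticCurrentsWindowLDUniformAllBeta (allBeta_pointwise_of_family h)

-- Targets: none yet (no line picked; `stuck_stubs = []`).

end Summit.AtomisticToContinuum.HydrodynamicLimit.Cruxes.KineticCurrentsLDAlongFamilies.Disproof

end
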